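import Summits.QuantumFields.YangMills.Theorems.BalabanUVNodesN16HolderOfThm4Output
import Summits.QuantumFields.YangMills.Theorems.BalabanUVNodesN16OfLeafRS
import HarnessLib

/-!
# Route «BalabanUVNodes», cluster K4 «SpineRates» — node N16 = NE3: THE N05 → N16 EDGE AT NODE N05's RESIDUAL HÖLDER EXPONENT —
# `n16_of_thm4Zd_print` ∕ `n16_of_leaf` ∕ `n16_of_b8LeafRS` with N05's family `zdGF3 (M_n ℂ) L β len` (ANY `β ∈ [0,1]`) and the β-root `CovRootHolder` as conclusion

Cell `pub-ymgap`, seat `pub-ymgap-dag-n16-c` (R134 fan-out seat, strategy s1; HUMAN RULING D-0062; chair R424 venue), generation 3, file 14 — module (D), the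
TOP of the producer column of repair R-β of the located item «the Hölder-exponent pin of N16's N05-socket» (`HOME/pub-ymgap-dag-n16-c/LOCATED-N16-HOLDER-PIN.md`;
pub-ymgap INBOX DAGN16C-G3-INTENT-1); over file 13 `…N16HolderOfThm4Output` (`n16_holder_of_thm4TorusAt_print`) and this seat's generation-0 files 2, 5, 6
(`…N16Thm4TorusOfZd` p453640: `thm4TorusAt_print_of_zd`; `…N16OfLeaf` p464578: `exists_window_print`, `thm4TorusAt_print_of_leaf {β} (0 ≤ β)`; `…N16OfLeafRS`
p465074) — all β-GENERIC BY NAME below their top theorems.  `--supports stmt-QuantumFields-19908` (helper).  `bears_on: R4∕N16 · edge N05 → N16`.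

WHY (the located item, decl level).  Node N05's leaf of record lives on n05-a's family `zdGF3 𝔸 L β len` ∕ NODE 00's `famB8OfRecord θ β len` at the RESIDUAL
Hölder exponent `β = 𝔯.β`, printed «β ≦ β₀ < 1» ([Balaban1985RegularSpaces] (1.36) p. 82; p. 83 «unavailable for the second order derivatives»; [Balaban1985BackgroundPropagators]
(3.43)–(3.45) «0 ≤ β ≤ β₀ < 1», constants «→ ∞ if β → 1»).  Generation 0's top theorems `n16_of_thm4Zd_print` ∕ `n16_of_leaf` ∕ `n16_of_b8LeafRS` read that family
at `β := 1` because their conclusion — the root of record `NE3EnergyRateWCov` = `N16At`'s body — pins (Lip₂′ᶜ) at `ξ³`.  THIS FILE is the same three theorems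
with `1 ↦ β`: the family at ANY `β ∈ [0, 1]` (`0 ≤ β` for the leaf's Hölder weights, `β ≤ 1` for print's letter conversion `η³ ≤ η^{2+β}`), ONE `(r, C)` for all
exponents (β quantified after `∃ C`), conclusion `CovRootHolder 4 (sfClass 4 L N ε) L N b g C s₁ s₂ β dom` (= `N16HolderDefs.N16HolderAt`'s body).  So N05's leaf
of record AT ITS OWN EXPONENT feeds N16's β-root by ONE theorem (`n16_holder_of_b8LeafRS`); at `β := 1` the three theorems of record return
(`N16HolderDefs.covRootHolder_one_iff`); and by `N16HolderWindow` the N19∕N21 consumers survive verbatim for `β > 2∕3`.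

WHAT THIS FILE PROVES (kernel, theorems only, 0 `def`, 0 sorry): §1 `n16_holder_of_thm4Zd_print` ((T4^ℤᵈ_print)_β, `β ≤ 1`) · §2 `n16_holder_of_leaf`
(`B8.Thm4Body ∧ B8.Prop3Body` on `zdGF3 (M_n ℂ) L β len` over the univ sub-index, `β ∈ [0,1]`) · §3 `n16_holder_of_b8LeafRS` (N05's leaf-of-record SHAPE
`B8LeafKnitRS.B8LeafRS` on that family, `β ∈ [0,1]`; only `t4`, `p3` read).
HONEST FRAMING: binder bookkeeping over LANDED theorems by name; the leaf clauses are node N05's theorems (in tree only modulo its sockets), (H3ˢᵘᵖ) is N07's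
([Balaban1985Variational] Thm 1 (8)+(10) TYPE); nothing of Bałaban's proved; **N16 ∕ NE3 NOT discharged**; the repair's statement edit (R-β ∕ R-Δ ∕ R-min) is
the planner's ∕ director's; count-neutral; one finite four-torus at fixed ε — NOT ℝ⁴, NOT infinite volume, NOT OS, NOT a mass gap, NOT Clay.
-/

set_option autoImplicit false

open scoped BigOperators Matrix Matrix.Norms.L2Operator
open NormedSpace

namespace Summit.QuantumFields.YangMills.BalabanUVNodes.N16HolderOfLeaf

open Literature.MathematicalPhysics.QuantumFieldTheory.Balaban1983to89
open B7Prop1Explicit B7Prop2Explicit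
open B7Prop3Flat (c3)
open T4AveragingDeficitWall (Ad)
open B7Eq92Concrete (mgauge)
open B8Ineq132 (covDerivFwd InAk)
open B8Eq184Proof (cfgExp)
open B8Eq119TwistedAxial (Restr129)
open B8Eq133Hypotheses (Reg335Zd)
open B8Eq138LandauZd (covLap IsLandau138)
open B8Thm4TorusAt (torusLam Thm4TorusAt)
open B8LeafModelZd (ZdIdx)
open B8LeafModelZd3 (zdGF3)
open B8LeafKnitRS (B8LeafRS)
open Summit.QuantumFields.BalabanUV.T4Continuum
open BlockAverageCurrent (curConst)
open NE3RightInverseSupLetters (frameC)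
open NE3.LeafIndexSockets (LeafH3sup)
open MinimalActionRate (sfClass)
open Summit.QuantumFields.YangMills.BalabanUVNodes.N16HolderDefs (CovRootHolder)
open Summit.QuantumFields.YangMills.BalabanUVNodes.N16HolderOfThm4Output (n16_holder_of_thm4TorusAt_print)
open Summit.QuantumFields.YangMills.BalabanUVNodes.N16 (thm4TorusAt_print_of_zd)
open Summit.QuantumFields.YangMills.BalabanUVNodes.N16.OfLeaf (exists_window_print thm4TorusAt_print_of_leaf)

noncomputable section

/-! ## §1 The `ℤᵈ` reading of Theorem 4 at exponent `β ≤ 1` -/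

section Knit

variable {n : Type*} [Fintype n] [DecidableEq n]

/-- **N16 · THE β-ROOT FROM THE `ℤᵈ` READING OF [B8] THEOREM 4 AT THE ALL-TORUS MEMBER (HÖLDER MEMBER AT EXPONENT `β ≤ 1`) AND N07's INTERFACE** (`d = 4`;
`L ≥ 2`, `N ≥ 1`) — generation 0's `N16.n16_of_thm4Zd_print` with `1 ↦ β`: file 13's `n16_holder_of_thm4TorusAt_print` with (T4ᵀ_print)_β REPLACED by
(T4^ℤᵈ_print)_β `∀ k ≥ 1, Thm4TorusAt L k 0 (Lᵏ)⁻¹ c₁ unitaryUnits (Reg335Zd (Lᵏ)⁻¹ L (𝒬 k) C₃₃₅) (Restr129 L k (torusLam k)) Concl⁰_print(B, B_h; β)` (no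
periodicity anywhere; uniqueness among all unitary gauges) plus the letter lines `0 ≤ B`, `16·B·c₁ ≤ 1`; conclusion `CovRootHolder 4 (sfClass 4 L N ε) L N b g C
s₁ s₂ β dom`.  `N16.thm4TorusAt_print_of_zd` (the periodicity principle, β-generic) ∘ file 13 §4.  N16 ∕ NE3 NOT proved: (T4^ℤᵈ_print)_β is node N05's theorem
([Balaban1985RegularSpaces] Thm 4 + Prop 3 at curved backgrounds, Hölder member as printed), (H3ˢᵘᵖ) is N07's. [folklore] -/
theorem n16_holder_of_thm4Zd_print [Nonempty n] {L N : ℕ} (hL : 2 ≤ L) (hN : 1 ≤ N) :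
    ∃ r : ℝ, 0 < r ∧ ∀ ⦃g : ℝ⦄, 0 < g → ∃ C : ℝ, 0 ≤ C ∧ ∀ (c₁ B Bh : ℝ), 0 ≤ B → 16 * (B * c₁) ≤ 1 → ∀ ⦃b' c' : ℝ⦄, 0 ≤ b' → 0 ≤ c' →
      2 ^ 15 * ((4 : ℝ) + 1) ^ 2 * ((4 : ℝ) + 4) ^ 2 * (L : ℝ) ^ 2 * b' ≤ 1 →
      23040 * (4 : ℝ) ^ 4 * (frameC 4 L + 4) ^ 3 * (c' + curConst 4 L * b' ^ 2) ≤ 1 →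
      ∀ ⦃α : ℝ⦄, 0 < α → C0 4 * α ≤ 1 / 3 → 2 * α ≤ c2' 4 L → 11 * (4 : ℝ) ^ 2 * α ≤ 1 / 6 → α + 11 * (4 : ℝ) ^ 2 * α ≤ c₁ →
      b' + 226 * (8 * ((4 : ℝ) + 1) * ((4 : ℝ) + 4)) ^ 2 * b' ^ 2 < α → 4 * ((4 : ℝ) - 1) * (c' + curConst 4 L * b' ^ 2) < α →
      ∀ ⦃Mc : ℝ⦄, 0 ≤ Mc → (Mc + 1) * (b' + 226 * (8 * ((4 : ℝ) + 1) * ((4 : ℝ) + 4)) ^ 2 * b' ^ 2) ≤ 1 / 2 →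
      ∀ (𝒬 : ℕ → Set (Set (Site 4) × ℕ)), (∀ k, ∀ q ∈ 𝒬 k, q.2 ≤ k ∧ ∃ y : Site 4, ∀ z ∈ q.1, (l1 (z - y) : ℝ) ≤ Mc * (L : ℝ) ^ q.2) →
      ∀ ⦃C335 : ℝ⦄, 2 * (Mc + 1) * (b' + 226 * (8 * ((4 : ℝ) + 1) * ((4 : ℝ) + 4)) ^ 2 * b' ^ 2) + 2 * Mc * (2 * (c' + curConst 4 L * b' ^ 2)) +
        4 * Mc * (1 + 2 * Mc) * (b' + 226 * (8 * ((4 : ℝ) + 1) * ((4 : ℝ) + 4)) ^ 2 * b' ^ 2) ^ 2 < C335 →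
      ∀ ⦃ε s₁ b s₂ : ℝ⦄, 0 < ε → ε ≤ r → ε < α → 0 ≤ s₁ → s₁ ≤ r → 0 ≤ b → b ≤ ε / 2 →
      B * (α + 11 * (4 : ℝ) ^ 2 * α) ≤ s₁ →
      B * (α + 11 * (4 : ℝ) ^ 2 * α) + 2 * (b' + 226 * (8 * ((4 : ℝ) + 1) * ((4 : ℝ) + 4)) ^ 2 * b' ^ 2) * s₁ ≤ s₁ →
      B * (α + 11 * (4 : ℝ) ^ 2 * α) + 16 * (b' + 226 * (8 * ((4 : ℝ) + 1) * ((4 : ℝ) + 4)) ^ 2 * b' ^ 2) * (B * (α + 11 * (4 : ℝ) ^ 2 * α)) ≤ s₁ →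
      Bh * (α + 11 * (4 : ℝ) ^ 2 * α) + 8 * (b' + 226 * (8 * ((4 : ℝ) + 1) * ((4 : ℝ) + 4)) ^ 2 * b' ^ 2) * (B * (α + 11 * (4 : ℝ) ^ 2 * α)) ≤ s₂ → ∀ ⦃β : ℝ⦄, β ≤ 1 →
      (∀ k, 1 ≤ k → Thm4TorusAt L k 0 (((L : ℝ) ^ k)⁻¹) c₁ (unitaryUnits (Matrix n n ℂ))
        (Reg335Zd (((L : ℝ) ^ k)⁻¹) L (𝒬 k) C335) (Restr129 L k (torusLam k))
        (fun (α₀ α₁ : ℝ) (U₀ U' : Site 4 → Fin 4 → (Matrix n n ℂ)ˣ) (u : Site 4 → (Matrix n n ℂ)ˣ) =>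
          ∃ A : Site 4 → Fin 4 → Matrix n n ℂ,
            (∀ x μ, IsSelfAdjoint (A x μ)) ∧ mgauge U₀ u (cfgExp (((L : ℝ) ^ k)⁻¹) A) = U' ∧
            (∀ x μ, ‖A x μ‖ ≤ B * (α₀ + α₁)) ∧
            (∀ (μ : Fin 4) (x : Site 4) (κ : Fin 4), ‖covDerivFwd (((L : ℝ) ^ k)⁻¹) U₀ μ (fun z => A z κ) x‖ ≤ B * (α₀ + α₁)) ∧
            IsLandau138 L k (((L : ℝ) ^ k)⁻¹) Set.univ (torusLam k) U₀ A ∧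
            (∀ (μ : Fin 4) (y : Site 4) (κ : Fin 4),
              ‖Ad (U₀ y μ) (covDerivFwd (((L : ℝ) ^ k)⁻¹) U₀ μ (fun z => A z κ) (y + e μ)) - covDerivFwd (((L : ℝ) ^ k)⁻¹) U₀ μ (fun z => A z κ) y‖
                ≤ Bh * (α₀ + α₁) * (((L : ℝ)⁻¹) ^ k) ^ β) ∧
            (∀ (x : Site 4) (κ : Fin 4), ‖covLap (((L : ℝ) ^ k)⁻¹) U₀ (fun z => A z κ) x‖ ≤ B * (α₀ + α₁)))) →
      ∀ {dom : _root_.Set (Site 4 → Fin 4 → (Matrix n n ℂ)ˣ)},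
        LeafH3sup 4 L N ε b' c' dom →
        CovRootHolder 4 (sfClass 4 L N ε) L N b g C s₁ s₂ β dom := by
  have hL1 : 1 ≤ L := by omega
  obtain ⟨r, hr0, hr⟩ := n16_holder_of_thm4TorusAt_print (n := n) hL hN
  refine ⟨r, hr0, fun g hg => ?_⟩
  obtain ⟨C, hC0, hC⟩ := hr hg
  refine ⟨C, hC0, fun c₁ B Bh hB hBc b' c' hb' hc' hRb hcF α hα hA3 hA2 hAs hAc hb'α hc'α Mc hMc hMcα 𝒬 h𝒬 C335 hC335 ε s₁ b s₂
    hε hεr hεα hs₁ hs₁r hb hbh hss hgrad hℓ hhol β hβ hT0 dom h3 => ?_⟩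
  have hηk : ∀ k : ℕ, 0 < ((L : ℝ) ^ k)⁻¹ ∧ ((L : ℝ) ^ k)⁻¹ ≤ 1 := fun k => by
    have hL1r : (1 : ℝ) ≤ L := by exact_mod_cast hL1
    have hLk : (1 : ℝ) ≤ (L : ℝ) ^ k := one_le_pow₀ hL1r
    exact ⟨by positivity, inv_le_one_of_one_le₀ hLk⟩
  exact hC c₁ B Bh hb' hc' hRb hcF hα hA3 hA2 hAs hAc hb'α hc'α hMc hMcα 𝒬 h𝒬 hC335 hε hεr hεα hs₁ hs₁r hb hbh hss hgrad hℓ hhol hβ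
    (fun k hk => thm4TorusAt_print_of_zd hL1 k N (hηk k).1 (hηk k).2 hB hBc _ (hT0 k hk)) h3

end Knit

/-! ## §2 N05's leaf clauses on `zdGF3 (M_n ℂ) L β len`, `β ∈ [0, 1]` -/

section Matrices

variable {n : Type} [Fintype n] [DecidableEq n]

/-- **N16 · THE β-ROOT FROM THE [B8] LEAF ON THE UNIV SUB-FAMILY OF `zdGF3 (M_n(ℂ)) L β len` AND N07's (H3ˢᵘᵖ)** (`d = 4`, `L ≥ 2`, `N ≥ 1`; `𝔸 = M_n(ℂ)` with the
`L²`-operator-norm C⋆-structure assembled in the statement; a length function `len ≥ 1` on its support with `len e_μ = 1`) — generation 0's `N16.OfLeaf.n16_of_leaf`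
with `1 ↦ β`: §1 with (T4^ℤᵈ_print)_β REPLACED by `B8.Thm4Body c₁ B₁′` ∧ `B8.Prop3Body cP 4 L C₂ inp B₀β` on `fun i ↦ zdGF3 (M_n(ℂ)) L β len i.1` over
`{i // i.Ω 0 = univ}` FOR ANY `β ∈ [0, 1]` (quantified after `∃ C`; what n05-a's `thm4Printed_zd3` ∕ `prop3Printed_zd3` deliver at the residual exponent, modulo
their sockets), the letters `0 < B₁′`, `5·4·L·B₀ ≤ B₁′`, the window at `c₁′`, `16·(5·4·L·B₀)·c₁′ ≤ 1`; Thm-4 output constants `B := 5·4·L·B₀`, `B_h := 5·4·L·B₀β`.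
`N16.OfLeaf.thm4TorusAt_print_of_leaf {β} (0 ≤ β)` ∘ §1.  N16 ∕ NE3 NOT proved: the leaf clauses are node N05's theorems, (H3ˢᵘᵖ) is N07's. [folklore] -/
theorem n16_holder_of_leaf [Nonempty n] {L N : ℕ} (hL : 2 ≤ L) (hN : 1 ≤ N) :
    letI : CStarAlgebra (Matrix n n ℂ) := {}
    ∃ r : ℝ, 0 < r ∧ ∀ ⦃g : ℝ⦄, 0 < g → ∃ C : ℝ, 0 ≤ C ∧
      ∀ (c₁ c₁' B₁' cP C₂ B₀β : ℝ) (inp : B8.B9Inputs) (len : Site 4 → ℝ), (∀ v : Site 4, 0 < len v → 1 ≤ len v) →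
      (∀ μ : Fin 4, len (e μ) = 1) → 0 < B₁' → 5 * ((4 : ℕ) : ℝ) * L * inp.B₀ ≤ B₁' → 16 * (5 * ((4 : ℕ) : ℝ) * L * inp.B₀ * c₁') ≤ 1 →
      (∀ α₀ α₁ : ℝ, 0 < α₀ → 0 < α₁ → α₀ + α₁ ≤ c₁' →
        α₀ + α₁ ≤ c₁ ∧ C0 4 * (2 * α₀) ≤ 1 / 3 ∧ 4 * α₀ ≤ c2' 4 L ∧ 16 * (B₁' * (α₀ + α₁)) ≤ 1 ∧
        Real.exp (4 * (800 * (((4 : ℕ) : ℝ) + 1) ^ 2 * (((4 : ℕ) : ℝ) + 4)) * α₀) *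
            (1 + 8 * (131072 * (((4 : ℕ) : ℝ) + 1) ^ 2) * (B₁' * (α₀ + α₁))) ≤ 2 ∧
        2 * (B₁' * (α₀ + α₁)) ≤ c3 4 L ∧ ((4 : ℕ) : ℝ) * L * α₁ ≤ 1 / 8 ∧ α₀ ≤ cP ∧ α₁ ≤ cP ∧ B₁' * (α₀ + α₁) ≤ cP ∧
        2 * (B₁' * (α₀ + α₁)) ^ 2 + 20 * ((4 : ℕ) : ℝ) * α₀ * (B₁' * (α₀ + α₁)) + 2 * C₂ * (B₁' * (α₀ + α₁)) ^ 2 ≤ α₀ + α₁) →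
      ∀ ⦃b' c' : ℝ⦄, 0 ≤ b' → 0 ≤ c' →
      2 ^ 15 * ((4 : ℝ) + 1) ^ 2 * ((4 : ℝ) + 4) ^ 2 * (L : ℝ) ^ 2 * b' ≤ 1 →
      23040 * (4 : ℝ) ^ 4 * (frameC 4 L + 4) ^ 3 * (c' + curConst 4 L * b' ^ 2) ≤ 1 →
      ∀ ⦃α : ℝ⦄, 0 < α → C0 4 * α ≤ 1 / 3 → 2 * α ≤ c2' 4 L → 11 * (4 : ℝ) ^ 2 * α ≤ 1 / 6 → α + 11 * (4 : ℝ) ^ 2 * α ≤ c₁' →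
      b' + 226 * (8 * ((4 : ℝ) + 1) * ((4 : ℝ) + 4)) ^ 2 * b' ^ 2 < α → 4 * ((4 : ℝ) - 1) * (c' + curConst 4 L * b' ^ 2) < α →
      ∀ ⦃Mc : ℝ⦄, 0 ≤ Mc → (Mc + 1) * (b' + 226 * (8 * ((4 : ℝ) + 1) * ((4 : ℝ) + 4)) ^ 2 * b' ^ 2) ≤ 1 / 2 →
      ∀ (𝒬 : ℕ → Set (Set (Site 4) × ℕ)), (∀ k, ∀ q ∈ 𝒬 k, q.2 ≤ k ∧ ∃ y : Site 4, ∀ z ∈ q.1, (l1 (z - y) : ℝ) ≤ Mc * (L : ℝ) ^ q.2) →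
      ∀ ⦃C335 : ℝ⦄, 2 * (Mc + 1) * (b' + 226 * (8 * ((4 : ℝ) + 1) * ((4 : ℝ) + 4)) ^ 2 * b' ^ 2) + 2 * Mc * (2 * (c' + curConst 4 L * b' ^ 2)) +
        4 * Mc * (1 + 2 * Mc) * (b' + 226 * (8 * ((4 : ℝ) + 1) * ((4 : ℝ) + 4)) ^ 2 * b' ^ 2) ^ 2 < C335 →
      ∀ ⦃ε s₁ b s₂ : ℝ⦄, 0 < ε → ε ≤ r → ε < α → 0 ≤ s₁ → s₁ ≤ r → 0 ≤ b → b ≤ ε / 2 →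
      5 * ((4 : ℕ) : ℝ) * L * inp.B₀ * (α + 11 * (4 : ℝ) ^ 2 * α) ≤ s₁ →
      5 * ((4 : ℕ) : ℝ) * L * inp.B₀ * (α + 11 * (4 : ℝ) ^ 2 * α) +
          2 * (b' + 226 * (8 * ((4 : ℝ) + 1) * ((4 : ℝ) + 4)) ^ 2 * b' ^ 2) * s₁ ≤ s₁ →
      5 * ((4 : ℕ) : ℝ) * L * inp.B₀ * (α + 11 * (4 : ℝ) ^ 2 * α) + 16 * (b' + 226 * (8 * ((4 : ℝ) + 1) * ((4 : ℝ) + 4)) ^ 2 * b' ^ 2) *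
          (5 * ((4 : ℕ) : ℝ) * L * inp.B₀ * (α + 11 * (4 : ℝ) ^ 2 * α)) ≤ s₁ →
      5 * ((4 : ℕ) : ℝ) * L * B₀β * (α + 11 * (4 : ℝ) ^ 2 * α) + 8 * (b' + 226 * (8 * ((4 : ℝ) + 1) * ((4 : ℝ) + 4)) ^ 2 * b' ^ 2) *
          (5 * ((4 : ℕ) : ℝ) * L * inp.B₀ * (α + 11 * (4 : ℝ) ^ 2 * α)) ≤ s₂ →
      ∀ ⦃β : ℝ⦄, 0 ≤ β → β ≤ 1 →
      B8.Thm4Body c₁ B₁' (fun i : {i : ZdIdx 4 L // i.Ω 0 = Set.univ} => (zdGF3 (Matrix n n ℂ) L β len i.1).toGFData) →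
      B8.Prop3Body cP 4 (L : ℝ) C₂ inp B₀β (fun i : {i : ZdIdx 4 L // i.Ω 0 = Set.univ} => (zdGF3 (Matrix n n ℂ) L β len i.1).toGFData2) →
      ∀ {dom : _root_.Set (Site 4 → Fin 4 → (Matrix n n ℂ)ˣ)},
        LeafH3sup 4 L N ε b' c' dom →
        CovRootHolder 4 (sfClass 4 L N ε) L N b g C s₁ s₂ β dom := by
  letI : CStarAlgebra (Matrix n n ℂ) := {}
  obtain ⟨r, hr0, hr⟩ := n16_holder_of_thm4Zd_print (n := n) hL hN
  refine ⟨r, hr0, fun g hg => ?_⟩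
  obtain ⟨C, hC0, hC⟩ := hr hg
  refine ⟨C, hC0, fun c₁ c₁' B₁' cP C₂ B₀β inp len hlen hlen1 hB₁' hBB h16 hwin b' c' hb' hc' hRb hcF α hα hA3 hA2 hAs hAc hb'α hc'α Mc hMc
    hMcα 𝒬 h𝒬 C335 hC335 ε s₁ b s₂ hε hεr hεα hs₁ hs₁r hb hbh hss hgrad hℓ hhol β hβ0 hβ1 hT hP dom h3 => ?_⟩
  have hB0 : 0 ≤ 5 * ((4 : ℕ) : ℝ) * L * inp.B₀ := by have := inp.B₀_pos.le; positivity
  have hT4 := thm4TorusAt_print_of_leaf (d := 4) (by norm_num) hL hβ0 hlen hlen1 hB₁' hBB hwin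
    (fun k => Reg335Zd (((L : ℝ) ^ k)⁻¹) L (𝒬 k) C335) hT hP
  exact hC c₁' (5 * ((4 : ℕ) : ℝ) * L * inp.B₀) (5 * ((4 : ℕ) : ℝ) * L * B₀β) hB0 h16 hb' hc' hRb hcF hα hA3 hA2 hAs hAc hb'α hc'α hMc
    hMcα 𝒬 h𝒬 hC335 hε hεr hεα hs₁ hs₁r hb hbh hss hgrad hℓ hhol hβ1 hT4 h3

/-! ## §3 N05's leaf of record SHAPE `B8LeafRS` on `zdGF3 (M_n ℂ) L β len`, `β ∈ [0, 1]` — the N05 → N16 edge at N05's residual exponent -/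

/-- **N16 · THE β-ROOT FROM NODE N05's LEAF OF RECORD ON `zdGF3 (M_n(ℂ)) L β len` OVER THE UNIV SUB-INDEX AND N07's (H3ˢᵘᵖ)** (`d = 4`, `L ≥ 2`, `N ≥ 1`,
ANY `β ∈ [0, 1]` — node N05's RESIDUAL Hölder exponent `𝔯.β`, printed «β ≦ β₀ < 1») — generation 0's `N16.OfLeafRS.n16_of_b8LeafRS` with `1 ↦ β`: `∃ r > 0, ∀ g > 0,
∃ C ≥ 0`, then for all `β ∈ [0,1]`, leaf parameters `C₂ B₁′ B₀′ B₁ B₂ c₁ inp B₀β`, carriers `loc lan cub toAxial`, a length function `len ≥ 1` on its support with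
`len e_μ = 1`, letters `0 < B₁′`, `5·4·L·B₀ ≤ B₁′`: the leaf `B8LeafRS 4 L C₂ B₁′ B₀′ B₁ B₂ c₁ inp B₀β loc (fun i ↦ zdGF3 (M_n ℂ) L β len i.1) lan cub toAxial` yields a
threshold `c₁′ > 0` with `16·(5·4·L·B₀)·c₁′ ≤ 1` such that §2's tail holds verbatim, ending in `LeafH3sup 4 L N ε b′ c′ dom → CovRootHolder 4 (sfClass 4 L N ε) L N b g C s₁ s₂
β dom`.  Only the leaf's `t4` and `p3` are read.  THE N05 → N16 EDGE WITH BOTH ENDS IN THEIR OWNERS' CURRENCIES AT THE PRINTED EXPONENT RANGE; at `β := 1` it is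
`n16_of_b8LeafRS` (`covRootHolder_one_iff`).  N16 ∕ NE3 NOT proved: the leaf is node N05's theorem, (H3ˢᵘᵖ) is N07's. [folklore] -/
theorem n16_holder_of_b8LeafRS [Nonempty n] {L N : ℕ} (hL : 2 ≤ L) (hN : 1 ≤ N) :
    letI : CStarAlgebra (Matrix n n ℂ) := {}
    ∃ r : ℝ, 0 < r ∧ ∀ ⦃g : ℝ⦄, 0 < g → ∃ C : ℝ, 0 ≤ C ∧
      ∀ {I₁ I₃ I₄ : Type} ⦃β : ℝ⦄, 0 ≤ β → β ≤ 1 → ∀ (C₂ B₁' B₀' B₁ B₂ c₁ : ℝ) (inp : B8.B9Inputs) (B₀β : ℝ) (loc : I₁ → B8.LocalData)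
        (lan : I₃ → B8.LandauData) (cub : I₄ → B8.CubeData) (len : Site 4 → ℝ)
        (toAxial : ∀ i : {i : ZdIdx 4 L // i.Ω 0 = Set.univ},
          (zdGF3 (Matrix n n ℂ) L β len i.1).Cfg → (zdGF3 (Matrix n n ℂ) L β len i.1).Pert → (zdGF3 (Matrix n n ℂ) L β len i.1).Pert),
      (∀ v : Site 4, 0 < len v → 1 ≤ len v) → (∀ μ : Fin 4, len (e μ) = 1) → 0 < B₁' → 5 * ((4 : ℕ) : ℝ) * L * inp.B₀ ≤ B₁' →
      B8LeafRS 4 (L : ℝ) C₂ B₁' B₀' B₁ B₂ c₁ inp B₀β loc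
        (fun i : {i : ZdIdx 4 L // i.Ω 0 = Set.univ} => zdGF3 (Matrix n n ℂ) L β len i.1) lan cub toAxial →
      ∃ c₁' : ℝ, 0 < c₁' ∧ 16 * (5 * ((4 : ℕ) : ℝ) * L * inp.B₀ * c₁') ≤ 1 ∧
      ∀ ⦃b' c' : ℝ⦄, 0 ≤ b' → 0 ≤ c' →
      2 ^ 15 * ((4 : ℝ) + 1) ^ 2 * ((4 : ℝ) + 4) ^ 2 * (L : ℝ) ^ 2 * b' ≤ 1 →
      23040 * (4 : ℝ) ^ 4 * (frameC 4 L + 4) ^ 3 * (c' + curConst 4 L * b' ^ 2) ≤ 1 →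
      ∀ ⦃α : ℝ⦄, 0 < α → C0 4 * α ≤ 1 / 3 → 2 * α ≤ c2' 4 L → 11 * (4 : ℝ) ^ 2 * α ≤ 1 / 6 → α + 11 * (4 : ℝ) ^ 2 * α ≤ c₁' →
      b' + 226 * (8 * ((4 : ℝ) + 1) * ((4 : ℝ) + 4)) ^ 2 * b' ^ 2 < α → 4 * ((4 : ℝ) - 1) * (c' + curConst 4 L * b' ^ 2) < α →
      ∀ ⦃Mc : ℝ⦄, 0 ≤ Mc → (Mc + 1) * (b' + 226 * (8 * ((4 : ℝ) + 1) * ((4 : ℝ) + 4)) ^ 2 * b' ^ 2) ≤ 1 / 2 →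
      ∀ (𝒬 : ℕ → Set (Set (Site 4) × ℕ)), (∀ k, ∀ q ∈ 𝒬 k, q.2 ≤ k ∧ ∃ y : Site 4, ∀ z ∈ q.1, (l1 (z - y) : ℝ) ≤ Mc * (L : ℝ) ^ q.2) →
      ∀ ⦃C335 : ℝ⦄, 2 * (Mc + 1) * (b' + 226 * (8 * ((4 : ℝ) + 1) * ((4 : ℝ) + 4)) ^ 2 * b' ^ 2) + 2 * Mc * (2 * (c' + curConst 4 L * b' ^ 2)) +
        4 * Mc * (1 + 2 * Mc) * (b' + 226 * (8 * ((4 : ℝ) + 1) * ((4 : ℝ) + 4)) ^ 2 * b' ^ 2) ^ 2 < C335 →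
      ∀ ⦃ε s₁ b s₂ : ℝ⦄, 0 < ε → ε ≤ r → ε < α → 0 ≤ s₁ → s₁ ≤ r → 0 ≤ b → b ≤ ε / 2 →
      5 * ((4 : ℕ) : ℝ) * L * inp.B₀ * (α + 11 * (4 : ℝ) ^ 2 * α) ≤ s₁ →
      5 * ((4 : ℕ) : ℝ) * L * inp.B₀ * (α + 11 * (4 : ℝ) ^ 2 * α) +
          2 * (b' + 226 * (8 * ((4 : ℝ) + 1) * ((4 : ℝ) + 4)) ^ 2 * b' ^ 2) * s₁ ≤ s₁ →
      5 * ((4 : ℕ) : ℝ) * L * inp.B₀ * (α + 11 * (4 : ℝ) ^ 2 * α) + 16 * (b' + 226 * (8 * ((4 : ℝ) + 1) * ((4 : ℝ) + 4)) ^ 2 * b' ^ 2) *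
          (5 * ((4 : ℕ) : ℝ) * L * inp.B₀ * (α + 11 * (4 : ℝ) ^ 2 * α)) ≤ s₁ →
      5 * ((4 : ℕ) : ℝ) * L * B₀β * (α + 11 * (4 : ℝ) ^ 2 * α) + 8 * (b' + 226 * (8 * ((4 : ℝ) + 1) * ((4 : ℝ) + 4)) ^ 2 * b' ^ 2) *
          (5 * ((4 : ℕ) : ℝ) * L * inp.B₀ * (α + 11 * (4 : ℝ) ^ 2 * α)) ≤ s₂ →
      ∀ {dom : _root_.Set (Site 4 → Fin 4 → (Matrix n n ℂ)ˣ)},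
        LeafH3sup 4 L N ε b' c' dom →
        CovRootHolder 4 (sfClass 4 L N ε) L N b g C s₁ s₂ β dom := by
  letI : CStarAlgebra (Matrix n n ℂ) := {}
  obtain ⟨r, hr0, hr⟩ := n16_holder_of_leaf (n := n) hL hN
  refine ⟨r, hr0, fun g hg => ?_⟩
  obtain ⟨C, hC0, hC⟩ := hr hg
  refine ⟨C, hC0, fun {I₁ I₃ I₄} β hβ0 hβ1 C₂ B₁' B₀' B₁ B₂ c₁ inp B₀β loc lan cub len toAxial hlen hlen1 hB₁' hBB leaf => ?_⟩
  -- the two thresholds of the leaf's `t4` ∕ `p3`, and the window threshold below them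
  obtain ⟨c₁t, hc₁t, hT⟩ := leaf.t4
  obtain ⟨cP, hcP, hP⟩ := leaf.p3
  obtain ⟨c₁', hc₁', hwin⟩ := exists_window_print (d := 4) (L := L) (by norm_num) hL C₂ hc₁t hcP hB₁'
  have hB0 : 0 ≤ 5 * ((4 : ℕ) : ℝ) * L * inp.B₀ := by have := inp.B₀_pos.le; positivity
  have h16 : 16 * (5 * ((4 : ℕ) : ℝ) * L * inp.B₀ * c₁') ≤ 1 := by
    obtain ⟨-, -, -, h, -⟩ := hwin (c₁' / 2) (c₁' / 2) (by linarith) (by linarith) (by linarith)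
    have h' : 16 * (B₁' * c₁') ≤ 1 := by rwa [add_halves] at h
    nlinarith [mul_le_mul_of_nonneg_right hBB hc₁'.le]
  refine ⟨c₁', hc₁', h16, fun b' c' hb' hc' hRb hcF α hα hA3 hA2 hAs hAc hb'α hc'α Mc hMc hMcα 𝒬 h𝒬 C335 hC335 ε s₁ b s₂ hε hεr hεα hs₁
    hs₁r hb hbh hss hgrad hℓ hhol dom h3 => ?_⟩
  exact hC c₁t c₁' B₁' cP C₂ B₀β inp len hlen hlen1 hB₁' hBB h16 hwin hb' hc' hRb hcF hα hA3 hA2 hAs hAc hb'α hc'α hMc hMcα 𝒬 h𝒬 hC335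
    hε hεr hεα hs₁ hs₁r hb hbh hss hgrad hℓ hhol hβ0 hβ1 hT hP h3

end Matrices

end

end Summit.QuantumFields.YangMills.BalabanUVNodes.N16HolderOfLeaf
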